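import Summits.ResolutionOfSingularities.ResolutionOfSingularities.Theorems.PurelyInseparableDim4PhiLineStepLawsTranslated
import Summits.ResolutionOfSingularities.ResolutionOfSingularities.Theorems.PurelyInseparableDim4PhiLineSupercritical
import HarnessLib

/-!
# (R3b-n) The LOSE-h law, TRANSLATED VARIANT, at a SUPERCRITICAL newborn letter (`r′_j + n ≤ p`, cleaning term in `(x_j^n)`)
# (cell `res-dim4-pi`, K2(p) lane, slice C `(5,4)` heavy line «D∞»; input L₄ of res-dim4-idea-1 g8's CARD I-1-10)

[OURS · counted 0 · cell `res-dim4-pi` · K2(p) lane holder res-dim4-p-12 g4; desk default (ii) 2026-08-29 07:29Z «heavy line WANTED,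
L₄ = p-2 g5»; seat res-dim4-p-2 g5 over its own (R3b) `…PhiLineStepLawsTranslated` and res-dim4-p-11 g5's (K-Φ2) XV
`…PhiLineSupercritical` ((T1) `pts_nonempty_and_alphaS_betaS_eq_of_cleaning_pow`).]  Nothing here proves TAIL-D, K2(5), the β_h line
or resolution of singularities in dimension ≥ 4 / characteristic `p` — NOT proved.  AI kernel work, weaker than expert review.

`betaS_step_le_of_lose_translated_of_child` (R3b) reads a LOSE-h step in a chart `j ≠ h` at a point with `b_j = 0`, `b_h ≠ 0` (the
critical letter `h` translated away, the newborn `x_j` of weight `r′_j = |r| + d − p` the new `u₁`), for a CRITICAL newborn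
(`hcrit′ : r′_j + d ≤ p`, so that the cleaning correction `R ∈ (x_j^{p − r′_j})` lies in `(x_j^d)` and (K-Φ3) V applies under
`αs′ < d!`).  At `(p, d) = (5, 4)` the newborn heavy letter has `r′_j = 2`, `p − r′_j = 3 < d` (SUPERCRITICAL): the correction lies in
`(x_j^3)` only.  **`betaS_step_le_of_lose_translated_of_child_pow`** is R3b with res-dim4-p-11 g5's two-token edit (bus 2026-08-29
07:27Z): `hcrit′` ↦ `(hcritn : r′_j + n ≤ p)` and the child's `αs′ < d!` ↦ `d·(αs′ + 1) ≤ n·d!` (on the chain: (K-Φ1)-n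
`PhiLine.mul_alphaS_le_of_isIsolated` at the isolated child), the cleaning transfer run from the CHILD side by (T1)
`pts_nonempty_and_alphaS_betaS_eq_of_cleaning_pow` (`H₀ = ε₀⁻¹G′ − ε₀⁻¹R`, no hypothesis on `ord₀ H₀` — res-dim4-p-11 g5's located
«order-raising cleaning», res-dim4-crit-2 g4 V-B-66, res-dim4-idea-1 g8 RUN-0 of I-1-9: `ord₀ H₀ = 3 < 4` occurs in class).  Same
conclusion: `αs′ + d! = δs` and `βs′ ≤ βs`.  The cleaning-free core `weakTransform_laws_of_lose_translated` is reused verbatim.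

[cite: CossartJannsenSaito2020, Lemma 12.1 (3), Lemma 12.2 (1), Lemma 13.6] [cite: CossartPiltant2008, Lemma 4.5 (2)] [cite: Hauser2010, §§F–G]
bears_on: LADDER-RESOLUTION:D157-DOOR2 (res-dim4-pi · K2(p) · slice C (5,4) heavy line · Φ-line (R3b-n)).  Supports
stmt-ResolutionOfSingularities-16155 (helper).
-/

set_option linter.dupNamespace false

noncomputable section

namespace Summit.ResolutionOfSingularities.ResolutionOfSingularities.Theorems.PIDim4

namespace PhiLine

open MvPolynomial Finset IsLocalRing
open Literature.AlgebraicGeometry.Resolution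
open Literature.AlgebraicGeometry.Resolution.Hauser2010
open Literature.AlgebraicGeometry.Resolution.WeightedOrder

variable {K : Type} [Field K]

/-- **LOSE-h ONE-STEP LAW, TRANSLATED VARIANT, SUPERCRITICAL NEWBORN** ((R3b) `betaS_step_le_of_lose_translated_of_child` with
`r′_j + d ≤ p` replaced by `r′_j + n ≤ p` and the cleaning transfer done from the CHILD side under `d·(αs′ + 1) ≤ n·d!`).  Let
`s.F = x^r · G` with `ord₀ G = d`, `p ≤ |r| + d`; chart letter `j ≠ h` at a point `b` with `b_j = 0`, `b_h ≠ 0`; `L` a left-invertible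
linear STEP frame (`u₁ = e_h`, the other rows through the new point) with non-empty polygon and `d! < δs` for `(G)`; `L′` the ARRIVAL
frame (`u₁′ = e_j` = the NEWBORN letter, of weight `r′_j = |r| + d − p` with `p ∤ r′_j` and `r′_j + n ≤ p`; the other rows of `L` with
the `j`-th coefficient dropped).  If the next residual `G′` (`(step p univ j b s).F = x^{r′} · G′`) has `ord₀ G′ ≥ d` and, in the arrival
frame, a non-empty polygon with `d·(αs′ + 1) ≤ n·d!` ((K-Φ1)-n at the isolated child), then **`αs′ + d! = δs`** and **`βs′ ≤ βs`**.
[OURS] [cite: CossartJannsenSaito2020, Lemma 12.1 (3), Lemma 12.2 (1), Lemma 13.6] [cite: CossartPiltant2008, Lemma 4.5 (2)] -/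
theorem betaS_step_le_of_lose_translated_of_child_pow {p d n : ℕ} [DecidableEq K] {s : State K} {r : Fin 4 →₀ ℕ}
    {G : MvPolynomial (Fin 4) K} (hF : s.F = monomial r 1 * G) (hd : ordZero G = d) (hp : p ≤ r.degree + d)
    {h j : Fin 4} (hjh : j ≠ h) {b : Fin 4 → K} (hbj : b j = 0) (hbh : b h ≠ 0)
    (hndvd : ¬ p ∣ (r.degree + d - p)) (hcritn : r.degree + d - p + n ≤ p)
    (L L' : Fin (2 + 2) → Fin 4 → K) (M M' : Fin 4 → Fin (2 + 2) → K)
    (hM : ∀ t u, ∑ i, M t i * L i u = if t = u then 1 else 0) (hM' : ∀ t u, ∑ i, M' t i * L' i u = if t = u then 1 else 0)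
    (hLu1 : L (u1 2) = Pi.single h 1)
    (hnear : ∀ i, i ≠ u1 2 → ∑ t, L i t * Function.update b j 1 t = 0)
    (hL'u1 : L' (u1 2) = Pi.single j 1) (hL' : ∀ i, i ≠ u1 2 → L' i = Function.update (L i) j 0)
    (hne : (pts (fun i => algebraMap (MvPolynomial (Fin 4) K) (OriginLocalization K 4) (∑ t, C (L i t) * X t))
      (Ideal.span {algebraMap (MvPolynomial (Fin 4) K) (OriginLocalization K 4) G}) d).Nonempty)
    (hδ : d.factorial < deltaS (fun i => algebraMap (MvPolynomial (Fin 4) K) (OriginLocalization K 4) (∑ t, C (L i t) * X t))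
      (Ideal.span {algebraMap (MvPolynomial (Fin 4) K) (OriginLocalization K 4) G}) d)
    {G' : MvPolynomial (Fin 4) K}
    (hF' : (CentreBlowup.step p Finset.univ j b s).F = monomial ((r.filter fun i => b i = 0).update j (r.degree + d - p)) 1 * G')
    (hd' : (d : ℕ∞) ≤ ordZero G')
    (hne' : (pts (fun i => algebraMap (MvPolynomial (Fin 4) K) (OriginLocalization K 4) (∑ t, C (L' i t) * X t))
      (Ideal.span {algebraMap (MvPolynomial (Fin 4) K) (OriginLocalization K 4) G'}) d).Nonempty)
    (hα' : d * (alphaS (fun i => algebraMap (MvPolynomial (Fin 4) K) (OriginLocalization K 4) (∑ t, C (L' i t) * X t))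
      (Ideal.span {algebraMap (MvPolynomial (Fin 4) K) (OriginLocalization K 4) G'}) d + 1) ≤ n * d.factorial) :
    alphaS (fun i => algebraMap (MvPolynomial (Fin 4) K) (OriginLocalization K 4) (∑ t, C (L' i t) * X t))
          (Ideal.span {algebraMap (MvPolynomial (Fin 4) K) (OriginLocalization K 4) G'}) d + d.factorial =
        deltaS (fun i => algebraMap (MvPolynomial (Fin 4) K) (OriginLocalization K 4) (∑ t, C (L i t) * X t))
          (Ideal.span {algebraMap (MvPolynomial (Fin 4) K) (OriginLocalization K 4) G}) d ∧
      betaS (fun i => algebraMap (MvPolynomial (Fin 4) K) (OriginLocalization K 4) (∑ t, C (L' i t) * X t))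
          (Ideal.span {algebraMap (MvPolynomial (Fin 4) K) (OriginLocalization K 4) G'}) d ≤
        betaS (fun i => algebraMap (MvPolynomial (Fin 4) K) (OriginLocalization K 4) (∑ t, C (L i t) * X t))
          (Ideal.span {algebraMap (MvPolynomial (Fin 4) K) (OriginLocalization K 4) G}) d := by
  have hdG : (d : ℕ∞) ≤ ordZero G := hd.symm.le
  obtain ⟨-, hαlaw, hβlaw⟩ := weakTransform_laws_of_lose_translated hdG hjh hbj hbh L L' M M' hM hM' hLu1 hnear hL'u1 hL' hne hδ
  set alg := algebraMap (MvPolynomial (Fin 4) K) (OriginLocalization K 4) with halg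
  set c' : Fin (2 + 2) → OriginLocalization K 4 := fun i => alg (∑ t, C (L' i t) * X t) with hc'
  have hc'u1 : c' (u1 2) = alg (X j) := by simp only [hc', hL'u1, sum_C_single_mul_X]
  have hgen' : Ideal.span (Set.range c') = maximalIdeal _ := span_range_linearFrame_eq_maximalIdeal L' M' hM'
  have hdim := ringKrullDim_originLocalization_two_add_two (K := K)
  -- the next residual `G′ = ε₀ H₀ + R`, `R ∈ (x_j^{p − r′_j}) ⊆ (x_j^n)`
  obtain ⟨R, hstep, hRmem⟩ := step_F_eq_monomial_mul_residual (p := p) hF hdG hp j hbj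
  rw [hF', monomial_one_mul_cancel_left_iff] at hstep
  have hr'j : ((r.filter fun i => b i = 0).update j (r.degree + d - p)) j = r.degree + d - p := by
    rw [Finsupp.coe_update, Function.update_self]
  have hR : R ∈ Ideal.span {(X j : MvPolynomial (Fin 4) K) ^ (p - (r.degree + d - p))} := by
    have := hRmem j (by rw [hr'j]; exact hndvd)
    rwa [hr'j] at this
  have hRn : R ∈ Ideal.span {(X j : MvPolynomial (Fin 4) K) ^ n} := by
    obtain ⟨q, rfl⟩ := Ideal.mem_span_singleton'.mp hR
    obtain ⟨k, hk⟩ := Nat.exists_eq_add_of_le (show n ≤ p - (r.degree + d - p) by omega)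
    rw [hk, Ideal.mem_span_singleton]
    exact Dvd.dvd.mul_left (pow_dvd_pow (X j) (Nat.le_add_right n k)) _
  have hε := constantCoeff_prod_ne_zero b (fun i => r i)
  obtain ⟨u, hu⟩ := isUnit_algebraMap_of_constantCoeff_ne_zero hε
  -- cleaning-blindness from the CHILD side ((T1), threshold `d(αs′+1) ≤ n·d!`): `H₀ = ε₀⁻¹ G′ − ε₀⁻¹ R`
  have hH₀ : alg (PointBlowup.translate b (CentreBlowup.chartTransform d Finset.univ j G)) =
      ((u⁻¹ : (OriginLocalization K 4)ˣ) : OriginLocalization K 4) * alg G' +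
        -(((u⁻¹ : (OriginLocalization K 4)ˣ) : OriginLocalization K 4) * alg R) := by
    have hu' : alg (∏ i ∈ Finset.univ.filter (fun i => b i ≠ 0), (X i + C (b i)) ^ r i) = (u : OriginLocalization K 4) := by
      rw [halg]; exact hu.symm
    rw [hstep, map_add, map_mul, hu', mul_add, Units.inv_mul_cancel_left, add_neg_cancel_right]
  have hclean := pts_nonempty_and_alphaS_betaS_eq_of_cleaning_pow c' hgen' hdim (Units.isUnit u⁻¹)
    (span_singleton_algebraMap_le_maximalIdeal_pow hd') hne' hα'
    (ρ := -(((u⁻¹ : (OriginLocalization K 4)ˣ) : OriginLocalization K 4) * alg R))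
    (by rw [hc'u1]; exact (Ideal.neg_mem_iff _).mpr (Ideal.mul_mem_left _ _ (algebraMap_mem_span_pow_of_mem_span_pow le_rfl hRn)))
  rw [← hH₀] at hclean
  refine ⟨?_, ?_⟩
  · rw [← hclean.2.1]; exact hαlaw
  · rw [← hclean.2.2]; exact hβlaw

end PhiLine

end Summit.ResolutionOfSingularities.ResolutionOfSingularities.Theorems.PIDim4

end
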